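import Summits.BirchSwinnertonDyer.BirchSwinnertonDyer.Theorems.AdditiveBranchIMCGordTwoRankOneHeegnerKolyvaginSelfTwistUnitsByName
import Summits.BirchSwinnertonDyer.BirchSwinnertonDyer.Theorems.AdditiveBranchIMCGordTwoRankOneHeegnerKolyvaginSelfTwistNecessity
import HarnessLib

/-!
# Route `AdditiveBranchIMC` (rung K1), crux `GordTwoRankOne` (item 19358): the HEIGHT-FREE
# Heegner–Kolyvagin road — Part 22f: the planner's support item `SelfTwistJSWIndexBoundUnits`
# (stmt-BirchSwinnertonDyer-23086) BY NAME, both ways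
# (cell `bsd-addord`, second prover lane `bsd-addord-k1-c3x`, gen 5; `--supports 19358 --as helper` only)

HONEST FRAMING. THEOREMS ONLY: no definition, no new named fact, no `sorry`; nothing is booked; BSD is
not proved by any of this; the crux (19358) and the support item (23086) stay OPEN. Planner g25 filed
`SelfTwistJSWIndexBoundUnits` (route file rev 13, 2026-08-27T22:20Z) = VERBATIM the `hL` binder of Part 22b's
`cellGordTwo_missingLowerBoundAt_rankOne_of_selfTwistIndexBoundUnits` (p577019) in route-file currency (with
`[DecidableEq K]` as item 20498), superseding the unit-free 23009 (misstated at `p = 3`, this seat's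
self-correction). THIS FILE wires it BY NAME:

* §10 `cellGordTwo_missingLowerBoundAt_rankOne_selfTwist_of_item` — item 23086 ⟹ LOWER(E,p) on the
  self-twist rows (`p ≡ 3 (mod 4)`, `p = 3` included) from PUBLISHED facts by name;
  `gordTwoRankOne_of_selfTwistItem_of_rest` — crux 19358 BY NAME ⟸ item 23086 + PUB + the displayed rest.
* §11 `selfTwistJSWIndexBoundUnits_of_gordTwoRankOne_of_lowerGoodTwist` — CONVERSELY item 23086 ⟸ crux 19358 +
  the rank-zero LOWER half for the GOOD ordinary `p*`-twists (`hLowV`, displayed; in the tree via BCS 2025 Cor.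
  1.3.1 at `p ≥ 5` / Skinner 2016 Thm. C under (ram)) + PUB (Part 22e's no-free-lunch): the item is EXACTLY as
  strong as the rows it serves, an equality under BSD (Part 22a).

References: [JetchevSkinnerWan2017] §7.4.1; [GrossZagier1986] I.(6.5), V.§2; [McCallumLMS1991] §1;
[Wuthrich2014] Prop. 21; [Mazur1978] Cor. 4.1; [Miller2011LMS] Def. 1.1.
-/

set_option autoImplicit false
set_option linter.dupNamespace false
noncomputable section

open scoped Classical NumberField
open WeierstrassCurve NumberField IsDedekindDomain
  Literature.NumberTheory.EllipticCurves Literature.NumberTheory.EllipticCurves.ModularForms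
  Literature.NumberTheory.EllipticCurves.Rank1Residual
  Literature.NumberTheory.EllipticCurves.Rank1Residual.Typed
  Summit.BirchSwinnertonDyer.Rank1Residual
  Summit.BirchSwinnertonDyer.Rank1Residual.Additive
  Summit.BirchSwinnertonDyer.BirchSwinnertonDyer.Theses.AdditiveBranchIMC

namespace Summit.BirchSwinnertonDyer.BirchSwinnertonDyer.Theorems.AdditiveBranchIMCGordTwoRankOne.HeegnerKolyvagin

/-! ### §10 Item 23086 BY NAME ⟹ the self-twist rows of the crux -/

/-- **Item `SelfTwistJSWIndexBoundUnits` (23086) BY NAME ⟹ LOWER(E,p) on the self-twist rows of cell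
(G-ord, `e = 2`)** at every `p ≡ 3 (mod 4)` (`p = 3`, `K = ℚ(ζ₃)` included), from the PUBLISHED facts by name
(Gross–Zagier, Kolyvagin qualitative, GZK, modularity, Wuthrich 2014 Prop. 21, newforms, Mazur 1978 Cor. 4.1, Néron
scaling): Part 22b's class theorem with its `hL` supplied by the route decl (the `[DecidableEq K]` binder of the
item is discharged classically). [cite: JetchevSkinnerWan2017, §7.4.1 (eq:shalower), pp. 30–31]
[cite: Wuthrich2014, Prop. 21 (p. 400)] [cite: Mazur1978, Cor. 4.1] -/
theorem cellGordTwo_missingLowerBoundAt_rankOne_selfTwist_of_item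
    (hItem : Summit.BirchSwinnertonDyer.BirchSwinnertonDyer.Theses.AdditiveBranchIMC.SelfTwistJSWIndexBoundUnits)
    (hGZ : ∀ (N : ℕ) [NeZero N] (V : WeierstrassCurve ℚ) (K : Type) [Field K] [NumberField K], gross_zagier N V K)
    (hKo : ∀ (N : ℕ) [NeZero N] (V : WeierstrassCurve ℚ) (K : Type) [Field K] [NumberField K], kolyvagin N V K)
    (hGZK : rank_eq_analyticRank_of_analyticRank_le_one) (hmod : hasEntireLFunction_rat)
    (hW21 : Wuthrich2014.sha_dvd_analyticSha) (hnf : exists_isNewformOf)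
    (hMaz : mazur_not_dvd_maninConstant_of_odd) (hNS : integral_neronScaling_of_isGloballyMinimal) :
    ∀ (W : WeierstrassCurve ℚ) [W.IsElliptic] [W.IsGloballyMinimal] (p : ℕ) [Fact p.Prime]
      (K : Type) [Field K] [NumberField K],
      W.analyticRank = 1 → N10.CellGordTwo W p → p % 4 = 3 → W.HasSurjectiveModNGaloisRep p →
      IsImaginaryQuadratic K → NumberField.discr K = -(p : ℤ) →
      (∀ ℓ : ℕ, ℓ.Prime → (ℓ : ℤ) ∣ ↑(W.conductorNorm ℤ) → ℓ ≠ p →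
        ((Ideal.span {(ℓ : ℤ)}).primesOver (𝓞 K)).ncard = 2) →
      (W.quadraticTwist (-(p : ℚ))).entireLFunction 1 ≠ 0 →
      Typed.MissingLowerBoundAt W p :=
  cellGordTwo_missingLowerBoundAt_rankOne_of_selfTwistIndexBoundUnits hGZ hKo hGZK hmod hW21 hnf hMaz hNS
    fun V _ _ p _ _ K _ _ W _ _ Cd Dt H ι P hg hL hs hK hd hH hCd hr hc2 hP hc hfin ↦
      hItem V p K W Cd Dt H ι P hg hL hs hK hd hH hCd hr hc2 hP hc hfin

/-- **Crux `GordTwoRankOne` (item 19358) BY NAME ⟸ item `SelfTwistJSWIndexBoundUnits` (23086) BY NAME + the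
PUBLISHED facts + the displayed REST** (every row of cell (G-ord, `e = 2`) admitting no self-twist frame:
`p ≡ 1 (mod 4)`, `ρ̄_{E,p}` not onto, some `ℓ ∣ N_E/p²` not split in `ℚ(√−p)`, or `L(E^{(−p)},1) = 0` — lane B's
earlier frame / lane A). An honest split; nothing booked; both items stay OPEN.
[cite: JetchevSkinnerWan2017, §7.4.1 (eq:shalower), pp. 30–31] [cite: Miller2011LMS, Def. 1.1] -/
theorem gordTwoRankOne_of_selfTwistItem_of_rest
    (hItem : Summit.BirchSwinnertonDyer.BirchSwinnertonDyer.Theses.AdditiveBranchIMC.SelfTwistJSWIndexBoundUnits)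
    (hGZ : ∀ (N : ℕ) [NeZero N] (V : WeierstrassCurve ℚ) (K : Type) [Field K] [NumberField K], gross_zagier N V K)
    (hKo : ∀ (N : ℕ) [NeZero N] (V : WeierstrassCurve ℚ) (K : Type) [Field K] [NumberField K], kolyvagin N V K)
    (hGZK : rank_eq_analyticRank_of_analyticRank_le_one) (hmod : hasEntireLFunction_rat)
    (hW21 : Wuthrich2014.sha_dvd_analyticSha) (hnf : exists_isNewformOf)
    (hMaz : mazur_not_dvd_maninConstant_of_odd) (hNS : integral_neronScaling_of_isGloballyMinimal)
    (hRest : ∀ (W : WeierstrassCurve ℚ) [W.IsElliptic] [W.IsGloballyMinimal] (p : ℕ) [Fact p.Prime],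
      W.analyticRank = 1 → N10.CellGordTwo W p →
      (∀ (K : Type) [Field K] [NumberField K], IsImaginaryQuadratic K → NumberField.discr K = -(p : ℤ) →
        p % 4 = 3 → W.HasSurjectiveModNGaloisRep p →
        (∀ ℓ : ℕ, ℓ.Prime → (ℓ : ℤ) ∣ ↑(W.conductorNorm ℤ) → ℓ ≠ p →
          ((Ideal.span {(ℓ : ℤ)}).primesOver (𝓞 K)).ncard = 2) →
        (W.quadraticTwist (-(p : ℚ))).entireLFunction 1 ≠ 0 → False) →
      Typed.MissingLowerBoundAt W p) :
    Summit.BirchSwinnertonDyer.BirchSwinnertonDyer.Theses.AdditiveBranchIMC.GordTwoRankOne :=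
  gordTwoRankOne_of_selfTwistIndexBoundUnits_of_rest hGZ hKo hGZK hmod hW21 hnf hMaz hNS
    (fun V _ _ p _ _ K _ _ W _ _ Cd Dt H ι P hg hL hs hK hd hH hCd hr hc2 hP hc hfin ↦
      hItem V p K W Cd Dt H ι P hg hL hs hK hd hH hCd hr hc2 hP hc hfin) hRest

/-! ### §11 Conversely: item 23086 ⟸ crux 19358 + the rank-zero LOWER half for the good twists -/

/-- **Item `SelfTwistJSWIndexBoundUnits` (23086) BY NAME ⟸ crux `GordTwoRankOne` (19358) BY NAME + the rank-zero
LOWER half `ord_p #Ш_an(V) ≤ ord_p #Ш(V)` for GOOD `p*`-twists `V` of analytic rank `0` with `ρ̄_{V,p}` onto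
(`hLowV`, displayed: Skinner–Urban's direction at a good ordinary prime; in the tree via BCS 2025 Cor. 1.3.1 at
`p ≥ 5`, PUB*, or Skinner 2016 Thm. C under (ram)) + PUBLISHED facts (`hGZ`, `hKo`, `hGZK`, `hmod`)** — Part 22e's
`selfTwistIndexBound_of_missingLowerBounds` at each frame. So 23086 is NECESSARY for the rows it serves (given the
rank-zero lower half for `V`), and an EQUALITY under `BSD(E,p) ∧ BSD(V,p)` (Part 22a). No free lunch.
[cite: JetchevSkinnerWan2017, §7.4.1, pp. 29–31] [cite: Miller2011LMS, Def. 1.1] -/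
theorem selfTwistJSWIndexBoundUnits_of_gordTwoRankOne_of_lowerGoodTwist
    (hCrux : Summit.BirchSwinnertonDyer.BirchSwinnertonDyer.Theses.AdditiveBranchIMC.GordTwoRankOne)
    (hLowV : ∀ (V : WeierstrassCurve ℚ) [V.IsElliptic] [V.IsGloballyMinimal] (p : ℕ) [Fact p.Prime],
      p ≠ 2 → V.HasGoodReductionAtPrime p → V.analyticRank = 0 → V.HasSurjectiveModNGaloisRep p →
      Typed.MissingLowerBoundAt V p)
    (hGZ : ∀ (N : ℕ) [NeZero N] (V : WeierstrassCurve ℚ) (K : Type) [Field K] [NumberField K], gross_zagier N V K)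
    (hKo : ∀ (N : ℕ) [NeZero N] (V : WeierstrassCurve ℚ) (K : Type) [Field K] [NumberField K], kolyvagin N V K)
    (hGZK : rank_eq_analyticRank_of_analyticRank_le_one) (hmod : hasEntireLFunction_rat) :
    Summit.BirchSwinnertonDyer.BirchSwinnertonDyer.Theses.AdditiveBranchIMC.SelfTwistJSWIndexBoundUnits := by
  intro V _ _ p _ _ K _ _ iDK W _ _ Cd Dt H ι P hg hLV hs hK hd hH hCd hr hc2 hP hc _
  -- the item's `[DecidableEq K]` binder versus the classical instance of the Theorems files
  have hDK : iDK = fun a b ↦ Classical.propDecidable (a = b) := Subsingleton.elim _ _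
  subst hDK
  have hp2 : p ≠ 2 := hc2.1
  have hr0 : V.analyticRank = 0 := (V.analyticRank_eq_zero_iff_holds (hmod V)).2 hLV
  have hLW : Typed.MissingLowerBoundAt W p := hCrux W p hr hc2
  have hLV0 : Typed.MissingLowerBoundAt V p := hLowV V p hp2 hg hr0 hs
  exact selfTwistIndexBound_of_missingLowerBounds hGZK hmod W p hp2 hr hLW V (V.conductorNorm ℤ) K hK hd Cd hCd hg
    hLV hLV0 hH (hGZ _ V K) (hKo _ V K) Dt H ι P hP hc

end Summit.BirchSwinnertonDyer.BirchSwinnertonDyer.Theorems.AdditiveBranchIMCGordTwoRankOne.HeegnerKolyvagin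

end
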